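import Summits.Ventures.YMGap.FlowData.TubeFluxNonAnnihilation
import Summits.Ventures.YMGap.Conjectures.TubeStringTension
import HarnessLib

/-!
# Venture YMGap, track Y3 FLOW-DATA — the d = 2 ANCHOR of the tube objects (slice dimension `k = 1`):
# `‖T‖ = c₀^L`, `‖T ∘ P₁‖ ≥ λ^L`, hence `E₁((ℤ/L)¹; β) ≤ L · (−ln u(β))` for the SU(2) tube (theorems only)

HONEST FRAMING: venture file of the cell `pub-ymgap` (QuantumFields programme), track Y3; companion THEOREMS for
`FlowData/TorelonEnergy.lean` and `Conjectures/TubeStringTension.lean`.  The module docstring of the typed law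
«L-Y3-σ» states that in slice dimension `k = 1` (theory dimension two) the law `E₁ < L·(−ln u)` degenerates to an
EQUALITY (exact solubility of `YM₂`: the transfer operator is diagonal in the characters of the holonomy).  This file
PROVES the `≤` half of that equality for the cell's ACTUAL typed objects — a STEP-0-style check that the conventions
(`J = β_W/2` in front of `Re tr`, twist element `−1`, `u = I₂/I₁ = ⟨cos α⟩_β`, `E₁ = log ‖T‖ − log ‖T ∘ P_{ê₀}‖`)
reproduce the exactly solvable two-dimensional value as an upper bound:

* `magSum_sliceOne` — a one-dimensional slice has no spatial plaquettes; `card_edge_sliceOne` — it has `L` links;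
* `tubeTransferOperator_const_sliceOne` — the constant function is an eigenfunction, `T 1 = c₀^L · 1`
  (`c₀ = ∫ e^{J Re tr ρ}`), and **`norm_tubeTransferOperator_sliceOne`**: `‖T‖ = c₀^L` (pair the positive
  eigenfunction `1` with Jentzsch's ground state, `TubeVacuumSector.exists_vacuum`);
* **`pow_schurScalar_le_tubeSectorNorm_sliceOne`** — the Polyakov-line state of `TubeFluxNonAnnihilation.lean` is
  the full holonomy trace here, `⟪ψ, Tψ⟫ = λ^L ‖ψ‖²`, so `λ^L ≤ ‖T ∘ P₁‖` (variational principle);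
* **`torelonEnergy_sliceOne_le`**: `E₁ ≤ L (log c₀ − log λ)` for `λ > 0`; for `SU(2)` (`λ/c₀ = u(β)`):
  **`su2TorelonEnergy_sliceOne_le`**: `su2TorelonEnergy β 1 L 0 ≤ L · (−log (su2CharacterRatio β))`, `β > 0`.
The reverse inequality (equality) needs the completeness of the `SU(2)` characters on class functions (Peter–Weyl)
and is NOT proved here.  Finite circles `(ℤ/L)¹` only; no number, no row, nothing about limits or a mass gap.

References: A. A. Migdal, Sov. Phys. JETP 42 (1975) 413; I. Montvay, G. Münster (1994) §3.2.6
[cite: MontvayMunster1994, §3.2.6]; M. Reed, B. Simon IV (1978) §XIII.12 [cite: ReedSimonIV1978, §XIII.12].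
-/

noncomputable section

open scoped BigOperators ENNReal
open MeasureTheory Filter Function
open Literature.MathematicalPhysics.QuantumFieldTheory Literature.Analysis.OperatorTheory

namespace Summit.Ventures.YMGap.FlowData

/-! ### The one-dimensional slice -/

section SliceOne

variable {G : Type*} [Group G] {n : ℕ} (ρ : G →* Matrix (Fin n) (Fin n) ℂ) {L : ℕ} [NeZero L]

/-- **A one-dimensional slice has no spatial plaquettes**: `magSum a = 0` for `k = 1`. [folklore] -/
theorem magSum_sliceOne (a : GaugeConfig 1 L G) : magSum (d := 1) (L := L) ρ a = 0 := by
  unfold magSum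
  refine Finset.sum_eq_zero fun x _ => Finset.sum_eq_zero fun p _ => ?_
  exfalso
  have h : p.1.1 = p.1.2 := Subsingleton.elim _ _
  exact absurd p.2 (by rw [h]; exact lt_irrefl _)

/-- The one-dimensional slice `(ℤ/L)¹` has `L` links. [folklore] -/
theorem card_edge_sliceOne : Fintype.card (Edge 1 L) = L := by
  simp only [Fintype.card_prod, Fintype.card_fun, ZMod.card, Fintype.card_fin, pow_one, mul_one]

/-- For `k = 1` the straight line along the unique axis at `t` is the link `(t, 0)`:
every link of the slice lies on it (the line map is a bijection onto the links). [folklore] -/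
theorem line_sliceOne_surjective :
    Surjective fun t : Fin L => ((Pi.single (0 : Fin 1) ((t : ℕ) : ZMod L), (0 : Fin 1)) : Edge 1 L) := by
  rintro ⟨x, i⟩
  refine ⟨⟨(x 0).val, ZMod.val_lt _⟩, ?_⟩
  have hi : i = 0 := Subsingleton.elim _ _
  subst hi
  refine Prod.ext (funext fun j => ?_) rfl
  have hj : j = 0 := Subsingleton.elim _ _
  subst hj
  simp only [Pi.single_eq_same, ZMod.natCast_val, ZMod.cast_id', id_eq]

end SliceOne

/-! ### `‖T‖ = c₀^L` and `‖T ∘ P₁‖ ≥ λ^L` on the circle -/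

section Circle

variable {G : Type*} [Group G] [TopologicalSpace G] [IsTopologicalGroup G] [CompactSpace G]
  [MeasurableSpace G] [BorelSpace G] [SecondCountableTopology G] {n : ℕ} (ρ : G →* Matrix (Fin n) (Fin n) ℂ)
  (J : ℝ) {L : ℕ} [NeZero L]

/-- **The constant function is an eigenfunction of the circle transfer operator**: `T 1 = c₀^L · 1`,
`c₀ = ∫ e^{J Re tr ρ}` (no spatial plaquettes; the temporal links gauge away; every link integrates to `c₀`).
[cite: MontvayMunster1994, §3.2.6] -/
theorem tubeTransferOperator_const_sliceOne (hρ : Continuous ρ) :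
    tubeTransferOperator ρ J 1 L ((memLp_const (1 : ℝ)).toLp (fun _ : GaugeConfig 1 L G => (1 : ℝ))) =
      (∫ g, Real.exp (J * (ρ g).trace.re) ∂haarProbability G) ^ L •
        (memLp_const (1 : ℝ)).toLp (fun _ : GaugeConfig 1 L G => (1 : ℝ)) := by
  set c0 : ℝ := ∫ g, Real.exp (J * (ρ g).trace.re) ∂haarProbability G with hc0
  set one : Lp ℝ 2 (sliceMeasure G 1 L) := (memLp_const (1 : ℝ)).toLp (fun _ : GaugeConfig 1 L G => (1 : ℝ)) with ho
  apply Lp.ext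
  have h1 := tubeTransferOperator_ae_eq J 1 L hρ one
  have hone : ((one : Lp ℝ 2 (sliceMeasure G 1 L)) : GaugeConfig 1 L G → ℝ) =ᵐ[sliceMeasure G 1 L] fun _ => 1 :=
    MemLp.coeFn_toLp _
  have hsm := Lp.coeFn_smul (c0 ^ L) one
  -- the kernel integrates to `c₀^L`
  have hK : ∀ a : GaugeConfig 1 L G, ∫ b, sliceKernel (d := 1) (L := L) ρ J J a b ∂(sliceMeasure G 1 L) = c0 ^ L := by
    intro a
    have h2 : ∀ b, sliceKernel (d := 1) (L := L) ρ J J a b =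
        (∫ E, Real.exp (J * elecSum (d := 1) (L := L) ρ a E b) ∂(Measure.pi fun _ : Site 1 L => haarProbability G)) *
          (fun _ : GaugeConfig 1 L G => (1 : ℝ)) b := by
      intro b
      simp only [sliceKernel, magSum_sliceOne, mul_zero, Real.exp_zero, one_mul, mul_one]
    simp_rw [h2]
    rw [integral_integral_exp_elecSum_mul ρ J hρ continuous_const (fun _ _ => rfl) a]
    simp only [mul_one]
    have h3 := integral_fintype_prod_eq_pow (ι := Edge 1 L) (μ := haarProbability G)
      (fun g : G => Real.exp (J * (ρ g).trace.re))
    rw [card_edge_sliceOne] at h3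
    exact h3
  have hint : ∀ a : GaugeConfig 1 L G, ∫ b, sliceKernel (d := 1) (L := L) ρ J J a b *
      ((one : Lp ℝ 2 (sliceMeasure G 1 L)) : GaugeConfig 1 L G → ℝ) b ∂(sliceMeasure G 1 L) = c0 ^ L := by
    intro a
    rw [← hK a]
    refine integral_congr_ae ?_
    filter_upwards [hone] with b hb
    rw [hb, mul_one]
  filter_upwards [h1, hsm, hone] with a ha hs ho
  rw [ha, hint, hs, Pi.smul_apply, ho, smul_eq_mul, mul_one]

/-- **The norm of the circle transfer operator: `‖T‖ = c₀^L`** — the a.e.-positive Jentzsch ground state `φ₀`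
(`T φ₀ = ‖T‖ φ₀`) is not orthogonal to the positive eigenfunction `1`, and `⟪T1, φ₀⟫ = ⟪1, Tφ₀⟫`.
[cite: ReedSimonIV1978, §XIII.12] -/
theorem norm_tubeTransferOperator_sliceOne (hρ : Continuous ρ) (hρu : ∀ g, ρ g ∈ Matrix.unitaryGroup (Fin n) ℂ) :
    ‖tubeTransferOperator ρ J 1 L‖ = (∫ g, Real.exp (J * (ρ g).trace.re) ∂haarProbability G) ^ L := by
  set T := tubeTransferOperator ρ J 1 L with hT
  set c0 : ℝ := ∫ g, Real.exp (J * (ρ g).trace.re) ∂haarProbability G with hc0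
  set one : Lp ℝ 2 (sliceMeasure G 1 L) := (memLp_const (1 : ℝ)).toLp (fun _ : GaugeConfig 1 L G => (1 : ℝ)) with ho
  obtain ⟨φ₀, -, hpos, heig, -, -⟩ :=
    (isPositivityImproving_tubeTransferOperator J 1 L hρ).exists_spectralGap
      (isSelfAdjoint_tubeTransferOperator J 1 L hρ hρu) (isCompactOperator_tubeTransferOperator J 1 L hρ)
      (tubeTransferOperator_ne_zero J 1 L hρ)
  have hsym := (ContinuousLinearMap.isSelfAdjoint_iff_isSymmetric.1 (isSelfAdjoint_tubeTransferOperator J 1 L hρ hρu))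
    one φ₀
  change @inner ℝ _ _ (T one) φ₀ = @inner ℝ _ _ one (T φ₀) at hsym
  rw [heig, tubeTransferOperator_const_sliceOne ρ J hρ, real_inner_smul_left, real_inner_smul_right] at hsym
  -- `⟪1, φ₀⟫ = ∫ φ₀ > 0`
  have hone : ((one : Lp ℝ 2 (sliceMeasure G 1 L)) : GaugeConfig 1 L G → ℝ) =ᵐ[sliceMeasure G 1 L] fun _ => 1 :=
    MemLp.coeFn_toLp _
  have hinner : @inner ℝ _ _ one φ₀ = ∫ a, φ₀ a ∂(sliceMeasure G 1 L) := by
    rw [MeasureTheory.L2.inner_def]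
    refine integral_congr_ae ?_
    filter_upwards [hone] with a ha
    rw [ha]
    simp
  have hφint : Integrable (φ₀ : GaugeConfig 1 L G → ℝ) (sliceMeasure G 1 L) := (Lp.memLp φ₀).integrable one_le_two
  have hpos' : 0 < ∫ a, φ₀ a ∂(sliceMeasure G 1 L) := by
    rw [integral_pos_iff_support_of_nonneg_ae (hpos.mono fun a ha => ha.le) hφint]
    rw [pos_iff_ne_zero]
    intro h0
    rw [measure_eq_zero_iff_ae_notMem] at h0
    have hfalse : ∀ᵐ a ∂(sliceMeasure G 1 L), False := by
      filter_upwards [h0, hpos] with a ha hp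
      exact ha (Function.mem_support.2 hp.ne')
    haveI : (ae (sliceMeasure G 1 L)).NeBot := ae_neBot.2 (IsProbabilityMeasure.ne_zero _)
    exact hfalse.exists.choose_spec
  change c0 ^ L * @inner ℝ _ _ one φ₀ = ‖T‖ * @inner ℝ _ _ one φ₀ at hsym
  rw [hinner] at hsym
  exact (mul_right_cancel₀ hpos'.ne' hsym).symm

/-- **Variational lower bound on the flux sector of the circle**: `λ^L ≤ ‖T ∘ P_{ê₀}‖`, `λ` the Schur scalar of the
one-link weight, for continuous `ρ` with `ρ(z) = −1` (the holonomy-trace state `ψ` lies in the sector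
and `⟪ψ, Tψ⟫ = λ^L ‖ψ‖²`). [folklore] -/
theorem pow_schurScalar_le_tubeSectorNorm_sliceOne (hρ : Continuous ρ) (hn : n ≠ 0) {z : G}
    (hρz : ρ z = -1) {lam : ℝ}
    (hM : ∀ i j, ∫ c, (Real.exp (J * (ρ c).trace.re) : ℂ) * ρ c i j ∂haarProbability G = if i = j then (lam : ℂ) else 0) :
    lam ^ L ≤ tubeSectorNorm ρ z J 1 L (Pi.single 0 1) := by
  set ℓ : Fin L → Edge 1 L := fun t => (Pi.single (0 : Fin 1) ((t : ℕ) : ZMod L), (0 : Fin 1)) with hℓ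
  set W : GaugeConfig 1 L G → ℝ := fun b => (ρ ((List.ofFn fun t : Fin L => b (ℓ t)).prod)).trace.re with hW
  set f : GaugeConfig 1 L G → ℝ := fun b => Real.exp (-(J / 2 * magSum (d := 1) (L := L) ρ b)) * W b with hf
  have hfW : ∀ b, f b = W b := fun b => by
    simp only [hf, magSum_sliceOne, mul_zero, neg_zero, Real.exp_zero, one_mul]
  have hWc : Continuous W :=
    Complex.continuous_re.comp ((hρ.comp (continuous_prod_ofFn_apply L ℓ)).matrix_trace)
  have hfc : Continuous f := by
    rw [show f = W from funext hfW]; exact hWc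
  obtain ⟨Cf, hCf⟩ := isCompact_univ.exists_bound_of_continuousOn hfc.continuousOn
  have hmem : MemLp f 2 (sliceMeasure G 1 L) :=
    MemLp.of_bound hfc.aestronglyMeasurable Cf (Eventually.of_forall fun b => hCf b (Set.mem_univ _))
  have heig : ∀ s : Fin 1 → ZMod 2, fluxTwistOp 1 L z s (hmem.toLp f) = fluxSign (Pi.single 0 1) s • hmem.toLp f := by
    intro s
    refine fluxTwistOp_toLp_eq_smul z s hmem _ fun b => ?_
    have hWs : W (fluxTwist z s b) = fluxSign (Pi.single 0 1) s * W b := by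
      simp only [hW, hℓ]
      exact lineTrace_fluxTwist ρ hρz 0 s b
    rw [hfW, hfW, hWs]
  have hP : tubeFluxProjection z 1 L (Pi.single 0 1) (hmem.toLp f) = hmem.toLp f :=
    tubeFluxProjection_apply_of_twist_eigen z heig
  -- `⟪ψ, Tψ⟫ = λ^L ∫ W²` (all `L` links lie on the line)
  have hinner := inner_tubeTransferOperator_pathState ρ J hρ hM ℓ (line_injective 0) (lineTrace_gaugeTransform ρ 0) hmem
  rw [card_edge_sliceOne, Nat.sub_self, pow_zero, one_mul] at hinner
  -- `‖ψ‖² = ∫ W²`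
  have hnorm : ‖hmem.toLp f‖ ^ 2 = ∫ b, W b ^ 2 ∂(sliceMeasure G 1 L) := by
    rw [← real_inner_self_eq_norm_sq, MeasureTheory.L2.inner_def]
    refine integral_congr_ae ?_
    filter_upwards [hmem.coeFn_toLp] with b hb
    rw [hb, hfW]
    simp [sq]
  have hW1 : W 1 = n := by
    have h : (List.ofFn fun t : Fin L => (1 : GaugeConfig 1 L G) (ℓ t)).prod = 1 := by
      simp only [Pi.one_apply, List.ofFn_const, List.prod_replicate, one_pow]
    simp only [hW, h, map_one, Matrix.trace_one, Fintype.card_fin, Complex.natCast_re]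
  have hW2 : 0 < ∫ b, W b ^ 2 ∂(sliceMeasure G 1 L) := by
    refine Continuous.integral_pos_of_hasCompactSupport_nonneg_nonzero (x := 1) (hWc.pow 2)
      (HasCompactSupport.of_compactSpace _) (fun b => sq_nonneg _) ?_
    rw [hW1]
    exact pow_ne_zero 2 (Nat.cast_ne_zero.2 hn)
  -- `⟪ψ, Tψ⟫ = ⟪ψ, (T ∘ P) ψ⟫ ≤ ‖T ∘ P‖ ‖ψ‖²`
  have hle : lam ^ L * ∫ b, W b ^ 2 ∂(sliceMeasure G 1 L) ≤
      tubeSectorNorm ρ z J 1 L (Pi.single 0 1) * ∫ b, W b ^ 2 ∂(sliceMeasure G 1 L) := by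
    rw [← hinner, ← hnorm]
    have h := real_inner_le_norm (hmem.toLp f)
      (((tubeTransferOperator ρ J 1 L).comp (tubeFluxProjection z 1 L (Pi.single 0 1))) (hmem.toLp f))
    rw [ContinuousLinearMap.comp_apply, hP] at h
    refine h.trans ?_
    have h2 := ((tubeTransferOperator ρ J 1 L).comp (tubeFluxProjection z 1 L (Pi.single 0 1))).le_opNorm (hmem.toLp f)
    rw [ContinuousLinearMap.comp_apply, hP] at h2
    unfold tubeSectorNorm sectorNorm
    calc ‖hmem.toLp f‖ * ‖tubeTransferOperator ρ J 1 L (hmem.toLp f)‖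
        ≤ ‖hmem.toLp f‖ * (‖(tubeTransferOperator ρ J 1 L).comp (tubeFluxProjection z 1 L (Pi.single 0 1))‖ *
            ‖hmem.toLp f‖) := mul_le_mul_of_nonneg_left h2 (norm_nonneg _)
      _ = ‖(tubeTransferOperator ρ J 1 L).comp (tubeFluxProjection z 1 L (Pi.single 0 1))‖ * ‖hmem.toLp f‖ ^ 2 := by
          ring
  exact le_of_mul_le_mul_right hle hW2

/-- **The two-dimensional anchor** (general form): on the circle `(ℤ/L)¹`, `E₁ ≤ L (log c₀ − log λ)` for the flux
energy along the unique axis, whenever the Schur scalar `λ` is positive (`‖T‖ = c₀^L`, `‖T ∘ P₁‖ ≥ λ^L`).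
[cite: MontvayMunster1994, §3.2.6] -/
theorem torelonEnergy_sliceOne_le (hρ : Continuous ρ) (hρu : ∀ g, ρ g ∈ Matrix.unitaryGroup (Fin n) ℂ) (hn : n ≠ 0)
    {z : G} (hρz : ρ z = -1) {lam : ℝ} (hlam : 0 < lam)
    (hM : ∀ i j, ∫ c, (Real.exp (J * (ρ c).trace.re) : ℂ) * ρ c i j ∂haarProbability G = if i = j then (lam : ℂ) else 0) :
    torelonEnergy ρ z J 1 L 0 ≤
      (L : ℝ) * (Real.log (∫ g, Real.exp (J * (ρ g).trace.re) ∂haarProbability G) - Real.log lam) := by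
  have hsec := pow_schurScalar_le_tubeSectorNorm_sliceOne ρ J (L := L) hρ hn hρz hM
  have hlamL : 0 < lam ^ L := pow_pos hlam L
  have h1 : Real.log (lam ^ L) ≤ Real.log (tubeSectorNorm ρ z J 1 L (Pi.single 0 1)) := Real.log_le_log hlamL hsec
  rw [Real.log_pow] at h1
  unfold torelonEnergy tubeFluxEnergy fluxEnergy
  rw [show sectorNorm (tubeTransferOperator ρ J 1 L) (fluxTwistOp 1 L z) (Pi.single 0 1) =
      tubeSectorNorm ρ z J 1 L (Pi.single 0 1) from rfl, norm_tubeTransferOperator_sliceOne ρ J hρ hρu, Real.log_pow,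
    mul_sub]
  linarith

end Circle

/-! ### The cell's object on the circle: `E₁ ≤ L · (−ln u(β))` -/

section SU2

open Literature.MathematicalPhysics.QuantumLattice (fundamentalRep fundamentalRep_apply continuous_fundamentalRep
  fundamentalRep_mem_unitaryGroup secondCountableTopology_su2)
open Summit.Ventures.LatticeQCDFlow.Exactness (su2a0)
open Summit.Ventures.LatticeQCDFlow.Scoring (onePlaquetteZSU2 onePlaquetteExpectSU2 onePlaquetteZSU2_pos)
open Summit.Ventures.YMGap.Conjectures (su2CharacterRatio su2CharacterRatio_pos)

/-- **The d = 2 anchor of the typed torelon energy**: on the circle `(ℤ/L)¹` (theory dimension two) the SU(2)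
torelon energy is bounded by its exactly solvable value, `su2TorelonEnergy β 1 L 0 ≤ L · (−ln u(β))`,
`u(β) = I₂(β)/I₁(β) = su2CharacterRatio β`, for every `L ≥ 1` and `β > 0`.  (Equality holds by the character
expansion; only `≤` is proved.) [cite: MontvayMunster1994, §3.2.6] -/
theorem su2TorelonEnergy_sliceOne_le {β : ℝ} (hβ : 0 < β) (L : ℕ) [NeZero L] :
    su2TorelonEnergy β 1 L 0 ≤ (L : ℝ) * (-Real.log (su2CharacterRatio β)) := by
  haveI : SecondCountableTopology (Matrix.specialUnitaryGroup (Fin 2) ℂ) := secondCountableTopology_su2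
  -- weight mass and Schur scalar of `SU(2)` at `J = β/2`; their ratio is `u(β)`
  have hc0 : (∫ g : Matrix.specialUnitaryGroup (Fin 2) ℂ, Real.exp (β / 2 * ((fundamentalRep (Fin 2) g).trace).re)
      ∂haarProbability (Matrix.specialUnitaryGroup (Fin 2) ℂ)) =
      ∫ U : Matrix.specialUnitaryGroup (Fin 2) ℂ, Real.exp (2 * (β / 2) * su2a0 U)
        ∂haarProbability (Matrix.specialUnitaryGroup (Fin 2) ℂ) :=
    integral_congr_ae (Eventually.of_forall fun U => su2_weight_eq (β / 2) U)
  have hu : (∫ U : Matrix.specialUnitaryGroup (Fin 2) ℂ, Real.exp (2 * (β / 2) * su2a0 U) * su2a0 U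
      ∂haarProbability (Matrix.specialUnitaryGroup (Fin 2) ℂ)) /
      (∫ U : Matrix.specialUnitaryGroup (Fin 2) ℂ, Real.exp (2 * (β / 2) * su2a0 U)
        ∂haarProbability (Matrix.specialUnitaryGroup (Fin 2) ℂ)) = su2CharacterRatio β := by
    rw [su2_schurScalar_div_weightMass (β / 2)]
    change Summit.Ventures.LatticeQCDFlow.Scoring.onePlaquetteExpectSU2 (2 * (β / 2)) Real.cos =
      Summit.Ventures.LatticeQCDFlow.Scoring.onePlaquetteExpectSU2 β Real.cos
    rw [show 2 * (β / 2) = β by ring]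
  have hc0pos := su2_weightMass_pos (β / 2)
  have hupos : 0 < su2CharacterRatio β := su2CharacterRatio_pos hβ
  have hlampos : 0 < ∫ U : Matrix.specialUnitaryGroup (Fin 2) ℂ, Real.exp (2 * (β / 2) * su2a0 U) * su2a0 U
      ∂haarProbability (Matrix.specialUnitaryGroup (Fin 2) ℂ) := by
    have h := div_mul_cancel₀ (∫ U : Matrix.specialUnitaryGroup (Fin 2) ℂ, Real.exp (2 * (β / 2) * su2a0 U) * su2a0 U
      ∂haarProbability (Matrix.specialUnitaryGroup (Fin 2) ℂ)) hc0pos.ne'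
    rw [hu] at h
    rw [← h]
    exact mul_pos hupos hc0pos
  have h := torelonEnergy_sliceOne_le (fundamentalRep (Fin 2)) (β / 2) (L := L) (continuous_fundamentalRep (Fin 2))
    fundamentalRep_mem_unitaryGroup two_ne_zero fundamentalRep_su2MinusOne hlampos
    (su2_integral_exp_mul_apply (β / 2))
  have key : Real.log (∫ g : Matrix.specialUnitaryGroup (Fin 2) ℂ,
      Real.exp (β / 2 * ((fundamentalRep (Fin 2) g).trace).re) ∂haarProbability (Matrix.specialUnitaryGroup (Fin 2) ℂ)) -
      Real.log (∫ U : Matrix.specialUnitaryGroup (Fin 2) ℂ, Real.exp (2 * (β / 2) * su2a0 U) * su2a0 U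
        ∂haarProbability (Matrix.specialUnitaryGroup (Fin 2) ℂ)) = -Real.log (su2CharacterRatio β) := by
    rw [hc0, ← neg_sub, ← Real.log_div hlampos.ne' hc0pos.ne', hu]
  rw [key] at h
  exact h

end SU2

end Summit.Ventures.YMGap.FlowData
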